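import Mathlib
import Summits.Ventures.HodgeRepro.Tier4.Common.AdelicDefs
import Summits.Ventures.HodgeRepro.Tier4.Line1.RationalPoints
import Summits.Ventures.HodgeRepro.Tier4.Line1.CocompactReduction
import Summits.Ventures.HodgeRepro.Tier4.Line1.LocallyCompactGA
import Summits.Ventures.HodgeRepro.Tier4.Line1.SecondCountableGA
import Summits.Ventures.HodgeRepro.Tier4.Line1.L2Infinite
import Summits.Ventures.HodgeRepro.Tier4.Line1.SignAdele

/-!
# Tier4/Line1/L2InfiniteGA — `L²(DG, μ)` is infinite-dimensional on `U(W)(𝔸_k)` (the J1 glue's hypothesis `hinf`)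

Blind re-derivation cell `pub-hodge-repro`, Tier 4 (README §9–§10), seat t4-L1-p5 (prover, LINE L1, gen 0).
S12636: the `orth` clause of `IsAdaptedONB` is an infinite orthonormal sequence, so the J1 glue needs
`L²(DG, μ)` infinite-dimensional.  Here it is for the DEFINED adelic group, any Haar measure and any relatively compact
fundamental domain of the rational points: `1` is not isolated in `U(W)(𝔸_k)` (`Tier4/Line1/SignAdele.lean`: the
sign scalars `ε_v • 1`, `ε_v = −1` at one finite place, tend to `1` along the infinitely many places), so the Haar
measure has null singletons (Mathlib's `IsHaarMeasure.nullSingletonClass`), `μ(DG) > 0` (a fundamental domain of a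
countable group), `μ(DG) < ∞` (compact closure), and `Tier4/Line1/L2Infinite.lean` applies.

Nothing here says anything about the status of the Hodge conjecture for CM abelian varieties, which is NOT proved
(HC_CM is NOT proved by anyone in this repository).
-/

set_option autoImplicit false

noncomputable section

namespace Summit.Ventures.HodgeRepro.Tier4.Line1

open NumberField Common MeasureTheory Topology
open scoped ENNReal

section Instance

variable {k : Type} [Field k] [NumberField k] (W : PlaneData k)

/-- **Haar measures on `U(W)(𝔸_k)` have null singletons** (`1` is not isolated). -/
theorem nullSingletonClass_haar_GA [MeasurableSpace (GA W)] [BorelSpace (GA W)] (μ : Measure (GA W))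
    [μ.IsHaarMeasure] : NullSingletonClass μ := by
  haveI := t2Space_GA W
  haveI := locallyCompact_GA W
  haveI := nhdsNE_one_neBot_GA W
  infer_instance

/-- **`L²(DG, μ)` is infinite-dimensional** for every Haar measure `μ` on `U(W)(𝔸_k)` and every fundamental domain
`DG` of `U(W)(k)` with compact closure — the hypothesis `hinf` of the J1 glue, discharged on the instance. -/
theorem not_finiteDimensional_L2_DG [MeasurableSpace (GA W)] [BorelSpace (GA W)] (μ : Measure (GA W))
    [μ.IsHaarMeasure] {D : Set (GA W)} (hD : IsFundamentalDomain (rationalPoints W) D μ)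
    (hDc : IsCompact (closure D)) : ¬ FiniteDimensional ℂ (Lp ℂ 2 (μ.restrict D)) := by
  haveI := t2Space_GA W
  haveI := locallyCompact_GA W
  haveI := secondCountable_GA W
  haveI := rationalPoints_countable W
  haveI := nullSingletonClass_haar_GA W μ
  have hD0 : μ D ≠ 0 := hD.measure_ne_zero (NeZero.ne μ)
  have hDtop : μ D ≠ ∞ :=
    ne_top_of_le_ne_top hDc.measure_lt_top.ne (measure_mono subset_closure)
  have hrestr : μ.restrict D = μ.restrict (toMeasurable μ D) :=
    (Measure.restrict_congr_set hD.nullMeasurableSet.toMeasurable_ae_eq).symm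
  rw [hrestr]
  apply not_finiteDimensional_Lp_two_restrict μ (measurableSet_toMeasurable μ D)
  · rw [measure_toMeasurable]
    exact pos_iff_ne_zero.2 hD0
  · rw [measure_toMeasurable]
    exact hDtop

end Instance

end Summit.Ventures.HodgeRepro.Tier4.Line1

end
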